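import Mathlib
import HarnessLib
import Literature.Analysis.FluidPDE.SwirlMaximumPrinciple
import Summits.NavierStokesRegularity.NavierStokesRegularity.Theorems.PoloidalWindowDoorPoloidalWindowRigidityWholeSpaceComparison

/-!
# The one-window door family — a whole-space maximum principle for BOUNDED SUB-solutions of drift–diffusion equations

Cell ns-regularity-ideate, seat p6 (route-directed support for nsreg-p1's door family; anchor
`--supports stmt-NavierStokesRegularity-20018`).  The comparison lemma consumed by the ENSTROPHY-PRODUCTION door
(`…LocalSineTubeDoorEnstrophyProductionDoor`): the enstrophy density `|ω|²` of a production-free profile is a bounded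
SUB-solution of `∂ₜq + (v·∇)q − Δq ≤ 0`, so its spatial supremum does not increase in time.

**Statement (`le_of_bounded_subsolution`).**  On `ℝ³ × [t₀, t₁]`: a classical SUB-solution `w` of
`∂ₜw + (b·∇)w − Δw ≤ 0` (jointly continuous, `C²` slices, classical time derivative `wt`) with drift bounded by the
constant `A`, BOUNDED (`|w| ≤ M`), and with `w(t₀, ·) ≤ N`, satisfies `w ≤ N` on the whole slab.

Proof = the one-sided half (`σ = 1`, constant super-barrier `Ψ ≡ N`) of ns-poloidal-K2-p3's
`…PoloidalWindowRigidityWholeSpaceComparison.sign_mul_le_of_superBarrier` (Lieberman 1996, Ch. II, Lemma 2.1/2.3 in the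
abstract form of the tree's `weak_max_principle`, with the quadratic barrier `ε e^{β(t−t₀)}(1 + ‖x‖²)`, `β = A + 7`),
adapted verbatim to the INEQUALITY `wt + Dw(b) − Δw ≤ 0` (the equality was used there only through this inequality for
`σ = 1`).

WHAT THIS IS NOT: not a claim about Navier–Stokes regularity — a linear parabolic comparison lemma (bears_on LADDER-NS
N0, door family support).
-/

noncomputable section

-- the summit and its single sub-problem share the name (CONVENTIONS §1), as in every Theorems file
set_option linter.dupNamespace false

namespace Summit.NavierStokesRegularity.NavierStokesRegularity.Theorems.LocalSineTubeDoorBoundedSubsolutionMaxPrinciple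

open MeasureTheory Set Function Filter Topology TopologicalSpace Metric InnerProductSpace
open scoped RealInnerProductSpace InnerProductSpace Laplacian ContDiff
open Literature.Analysis Literature.Analysis.FluidPDE
open Summit.NavierStokesRegularity.NavierStokesRegularity.Theorems.PoloidalWindowDoorPoloidalWindowRigidityWholeSpaceComparison

/-- **Whole-space maximum principle for bounded sub-solutions.**  On `ℝ³ × [t₀, t₁]`, a classical sub-solution `w`
of `∂ₜw + (b·∇)w − Δw ≤ 0` with `‖b‖ ≤ A`, `|w| ≤ M` and `w(t₀, ·) ≤ N` satisfies `w ≤ N` everywhere on the slab.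
(Adapted from `…WholeSpaceComparison.sign_mul_le_of_superBarrier`, ns-poloidal-K2-p3, to sub-solutions.) -/
theorem le_of_bounded_subsolution {b : ℝ → EuclideanSpace ℝ (Fin 3) → EuclideanSpace ℝ (Fin 3)} {A M N : ℝ}
    {w wt : ℝ → EuclideanSpace ℝ (Fin 3) → ℝ} {t₀ t₁ : ℝ} (ht01 : t₀ < t₁)
    (hbA : ∀ t ∈ Icc t₀ t₁, ∀ x, ‖b t x‖ ≤ A)
    (hw_c : ContinuousOn (uncurry w) (Icc t₀ t₁ ×ˢ univ))
    (hw2 : ∀ t ∈ Icc t₀ t₁, ContDiff ℝ 2 (w t))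
    (hwt : ∀ x, ∀ t ∈ Icc t₀ t₁, HasDerivAt (fun τ => w τ x) (wt t x) t)
    (hlaw : ∀ t ∈ Icc t₀ t₁, ∀ x, wt t x + fderiv ℝ (w t) x (b t x) - (Δ (w t)) x ≤ 0)
    (hbdd : ∀ t ∈ Icc t₀ t₁, ∀ x, |w t x| ≤ M)
    (hinit : ∀ x, w t₀ x ≤ N) :
    ∀ t ∈ Icc t₀ t₁, ∀ x, w t x ≤ N := by
  have ht00 : t₀ ∈ Icc t₀ t₁ := ⟨le_rfl, ht01.le⟩
  have hA0 : 0 ≤ A := (norm_nonneg _).trans (hbA t₀ ht00 0)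
  have hM0 : 0 ≤ M := (abs_nonneg _).trans (hbdd t₀ ht00 0)
  -- the rate of the barrier
  set β : ℝ := A + 7 with hβ
  have hβ0 : 0 ≤ β := by rw [hβ]; positivity
  -- the claim for every `ε > 0`, on every large ball
  suffices key : ∀ ε : ℝ, 0 < ε → ∀ R : ℝ, 1 ≤ R → (M + |N|) / ε ≤ R →
      ∀ t ∈ Icc t₀ t₁, ∀ x ∈ closedBall (0 : EuclideanSpace ℝ (Fin 3)) R,
        w t x - N - ε * Real.exp (β * (t - t₀)) * (1 + ‖x‖ ^ 2) ≤ 0 by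
    intro t ht x
    refine le_of_forall_pos_le_add fun η hη => ?_
    set C : ℝ := Real.exp (β * (t - t₀)) * (1 + ‖x‖ ^ 2) with hC
    have hCpos : 0 < C := by positivity
    set R : ℝ := max (max 1 ((M + |N|) / (η / C))) ‖x‖ with hR
    have h := key (η / C) (div_pos hη hCpos) R ((le_max_left _ _).trans (le_max_left _ _))
      ((le_max_right _ _).trans (le_max_left _ _)) t ht x (mem_closedBall_zero_iff.2 (le_max_right _ _))
    have e : η / C * Real.exp (β * (t - t₀)) * (1 + ‖x‖ ^ 2) = η := by
      rw [hC]; field_simp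
    rw [e] at h
    linarith
  intro ε hε R hR1 hR
  -- the comparison function and its time derivative
  set W : ℝ → EuclideanSpace ℝ (Fin 3) → ℝ := fun t x =>
    w t x - N - ε * Real.exp (β * (t - t₀)) * (1 + ‖x‖ ^ 2) with hW
  set Wt : ℝ → EuclideanSpace ℝ (Fin 3) → ℝ := fun t x =>
    wt t x - β * (ε * Real.exp (β * (t - t₀)) * (1 + ‖x‖ ^ 2)) with hWt
  set K : Set (EuclideanSpace ℝ (Fin 3)) := closedBall 0 R with hK
  set U : Set (EuclideanSpace ℝ (Fin 3)) := ball 0 R with hU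
  have hKc : IsCompact K := isCompact_closedBall _ _
  have hUo : IsOpen U := isOpen_ball
  have hUK : U ⊆ K := ball_subset_closedBall
  -- (a) joint continuity
  have hc : ContinuousOn (uncurry W) (Icc t₀ t₁ ×ˢ K) := by
    have hwc : ContinuousOn (uncurry w) (Icc t₀ t₁ ×ˢ K) := hw_c.mono (prod_mono Subset.rfl (subset_univ _))
    have h2 : Continuous fun p : ℝ × EuclideanSpace ℝ (Fin 3) =>
        ε * Real.exp (β * (p.1 - t₀)) * (1 + ‖p.2‖ ^ 2) := by fun_prop
    refine ((hwc.sub (continuousOn_const (c := N))).sub h2.continuousOn).congr fun p _ => ?_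
    simp only [hW, uncurry, Pi.sub_apply]
  -- (b) smooth slices
  have h2 : ∀ t ∈ Ioc t₀ t₁, ContDiff ℝ 2 (W t) := fun t ht =>
    (((hw2 t ⟨ht.1.le, ht.2⟩)).sub contDiff_const).sub (contDiff_quadBarrier (ε * Real.exp (β * (t - t₀))))
  -- (c) the time derivative
  have hWt' : ∀ t ∈ Ioc t₀ t₁, ∀ x ∈ U, HasDerivWithinAt (fun s => W s x) (Wt t x) (Icc t₀ t) t := by
    intro t ht x _
    have htI : t ∈ Icc t₀ t₁ := ⟨ht.1.le, ht.2⟩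
    have hexp : HasDerivAt (fun s => ε * Real.exp (β * (s - t₀)) * (1 + ‖x‖ ^ 2))
        (ε * (Real.exp (β * (t - t₀)) * β) * (1 + ‖x‖ ^ 2)) t := by
      have h1 : HasDerivAt (fun s => Real.exp (β * (s - t₀))) (Real.exp (β * (t - t₀)) * β) t := by
        have := (((hasDerivAt_id t).sub_const t₀).const_mul β).exp
        simpa using this
      exact (h1.const_mul ε).mul_const (1 + ‖x‖ ^ 2)
    have h := ((hwt x t htI).sub_const N).sub hexp
    refine (h.hasDerivWithinAt (s := Icc t₀ t)).congr_deriv ?_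
    simp only [hWt]; ring
  -- (d) the sub-solution implication, from the inequality and the barrier
  have hsub : ∀ t ∈ Ioc t₀ t₁, ∀ x ∈ U, fderiv ℝ (W t) x = 0 → (Δ (W t)) x ≤ 0 → Wt t x ≤ 0 := by
    intro t ht x _ hgrad hlap
    have htI : t ∈ Icc t₀ t₁ := ⟨ht.1.le, ht.2⟩
    set c : ℝ := ε * Real.exp (β * (t - t₀)) with hcdef
    have hc0 : 0 < c := by positivity
    have hwd : DifferentiableAt ℝ (w t) x := ((hw2 t htI).differentiable two_ne_zero) x
    have hB := hasFDerivAt_quadBarrier c x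
    have hWderiv : HasFDerivAt (W t) (fderiv ℝ (w t) x -
        c • ((2 : ℕ) • (innerSL ℝ x : EuclideanSpace ℝ (Fin 3) →L[ℝ] ℝ))) x := by
      have h := (hwd.hasFDerivAt.sub_const N).sub hB
      simp only [hW, hcdef]
      exact h
    have hDeq : fderiv ℝ (w t) x = c • ((2 : ℕ) • (innerSL ℝ x : EuclideanSpace ℝ (Fin 3) →L[ℝ] ℝ)) := by
      have := hWderiv.fderiv
      rw [hgrad] at this
      exact (sub_eq_zero.1 this.symm)
    have hDapply : ∀ a : EuclideanSpace ℝ (Fin 3), fderiv ℝ (w t) x a = c * (2 * ⟪x, a⟫_ℝ) := fun a => by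
      have := congrArg (fun L : EuclideanSpace ℝ (Fin 3) →L[ℝ] ℝ => L a) hDeq
      simpa [innerSL_apply_apply, nsmul_eq_mul] using this
    -- Laplacians
    have hΔeq : (Δ (W t)) x = (Δ (w t)) x - 6 * c := by
      have h1' : ContDiffAt ℝ 2 (fun y => w t y - N) x := ((hw2 t htI).sub contDiff_const).contDiffAt
      have h2' : ContDiffAt ℝ 2 (fun y : EuclideanSpace ℝ (Fin 3) => (c * (1 + ‖y‖ ^ 2) : ℝ)) x :=
        (contDiff_quadBarrier c).contDiffAt
      have h4 : (Δ (fun y => w t y - N)) x = (Δ (w t)) x := by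
        have e : (fun y => w t y - N) = w t - fun _ => N := by funext y; simp
        rw [e, (hw2 t htI).contDiffAt.laplacian_sub contDiffAt_const]
        simp [InnerProductSpace.laplacian_const]
      have hfun : W t = (fun y => w t y - N) -
          fun y : EuclideanSpace ℝ (Fin 3) => (c * (1 + ‖y‖ ^ 2) : ℝ) := by
        funext y; simp only [hW, hcdef, Pi.sub_apply]
      rw [hfun, h1'.laplacian_sub h2', h4, laplacian_quadBarrier]
    have hΔ : (Δ (w t)) x ≤ 6 * c := by rw [hΔeq] at hlap; linarith
    -- the inequality for `w`
    have hlaw' : wt t x ≤ (Δ (w t)) x - fderiv ℝ (w t) x (b t x) := by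
      have h := hlaw t htI x; linarith
    -- drift term
    have hb := hbA t htI x
    have hdrift2 : -(c * (2 * ⟪x, b t x⟫_ℝ)) ≤ c * (2 * (‖x‖ * A)) := by
      have h1 : |⟪x, b t x⟫_ℝ| ≤ ‖x‖ * ‖b t x‖ := abs_real_inner_le_norm _ _
      have h2 : ‖x‖ * ‖b t x‖ ≤ ‖x‖ * A := mul_le_mul_of_nonneg_left hb (norm_nonneg _)
      have h3 := (abs_le.1 (h1.trans h2)).1
      nlinarith
    have hσwt : wt t x ≤ 6 * c + c * (2 * (‖x‖ * A)) := by
      rw [hDapply (b t x)] at hlaw'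
      linarith
    -- conclude with `β = A + 7`: `6c + 2cA‖x‖ ≤ β c (1 + ‖x‖²)`
    have hx2 : 2 * (‖x‖ * A) ≤ A * (1 + ‖x‖ ^ 2) := by nlinarith [sq_nonneg (‖x‖ - 1), norm_nonneg x]
    have hkey : 6 * c + c * (2 * (‖x‖ * A)) ≤ β * (c * (1 + ‖x‖ ^ 2)) := by
      have h1 : c * (2 * (‖x‖ * A)) ≤ c * (A * (1 + ‖x‖ ^ 2)) := mul_le_mul_of_nonneg_left hx2 hc0.le
      have h2 : 6 * c ≤ 7 * (c * (1 + ‖x‖ ^ 2)) := by nlinarith [sq_nonneg ‖x‖]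
      rw [hβ]; nlinarith
    have e3 : Wt t x = wt t x - β * (c * (1 + ‖x‖ ^ 2)) := by simp only [hWt, hcdef]
    rw [e3]
    linarith
  -- (e) the parabolic boundary: `t = t₀`
  have hbot : ∀ x ∈ K, W t₀ x ≤ 0 := by
    intro x _
    simp only [hW, sub_self, mul_zero, Real.exp_zero, mul_one]
    have h2 := hinit x
    have h3 : 0 ≤ ε * (1 + ‖x‖ ^ 2) := by positivity
    linarith
  -- (f) the parabolic boundary: the sphere `‖x‖ = R`
  have hlat : ∀ t ∈ Icc t₀ t₁, ∀ x ∈ K \ U, W t x ≤ 0 := by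
    intro t ht x hx
    have hexp1 : 1 ≤ Real.exp (β * (t - t₀)) := Real.one_le_exp (mul_nonneg hβ0 (by linarith [ht.1]))
    have hH : ε * (1 + ‖x‖ ^ 2) ≤ ε * Real.exp (β * (t - t₀)) * (1 + ‖x‖ ^ 2) := by
      have : ε * (1 + ‖x‖ ^ 2) * 1 ≤ ε * (1 + ‖x‖ ^ 2) * Real.exp (β * (t - t₀)) :=
        mul_le_mul_of_nonneg_left hexp1 (by positivity)
      linarith
    have hxK : ‖x‖ ≤ R := mem_closedBall_zero_iff.1 hx.1
    have hxR : ‖x‖ = R := by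
      have hnot : x ∉ ball (0 : EuclideanSpace ℝ (Fin 3)) R := hx.2
      have : R ≤ ‖x‖ := by simpa using hnot
      exact le_antisymm hxK this
    have h1 : w t x - N ≤ M + |N| := by
      have ha := (abs_le.1 (hbdd t ht x)).2
      have hb := neg_le_abs N
      linarith
    have h2 : M + |N| ≤ ε * (1 + ‖x‖ ^ 2) := by
      rw [hxR]
      have h3 : M + |N| ≤ ε * R := by rw [div_le_iff₀ hε] at hR; linarith
      have hR2 : R ≤ 1 + R ^ 2 := by nlinarith
      have h4 : ε * R ≤ ε * (1 + R ^ 2) := mul_le_mul_of_nonneg_left hR2 hε.le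
      linarith
    simp only [hW]
    linarith
  have hmain := weak_max_principle hKc hUo hUK hc h2 hWt' hsub hbot hlat
  intro t ht x hx
  have := hmain t ht x hx
  simpa only [hW] using this

end Summit.NavierStokesRegularity.NavierStokesRegularity.Theorems.LocalSineTubeDoorBoundedSubsolutionMaxPrinciple

end
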